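import Literature.Computability.Cryptography.HallgrenClassGroupCharacterCoordinates
import Mathlib.Analysis.SpecialFunctions.Complex.CircleAddChar
import Mathlib.GroupTheory.Index
import Mathlib.GroupTheory.QuotientGroup.Basic
import HarnessLib

/-!
# The class-group stage: the dual group `Λ^*/ℤ^T` of a finite-index lattice as an annihilator in `(ℤ/h)^T`

Topic `Computability/Cryptography`; algebra behind the post-processing of the class-group stage of the crux
`LinnikCubicClassGroups.PureCubicClassGroupFBQP` (line `arakelov-giant-step-cycle`; consumer: the proof of
`CubicClassSampling.ClaimPost`). For a lattice `Λ ≤ ℤ^T` of finite index `h`, the characters of `ℤ^T/Λ` are the vectors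
`ξ ∈ [0,1)^T ∩ ℚ^T` pairing integrally with `Λ` (`CubicClassSampling.dualReps`); since `h ℤ^T ≤ Λ` every such `ξ` lies in
`((1/h)ℤ)^T`, and `ξ ↦ h ξ mod h` identifies them with the **annihilator** `annih h Λ = {a ∈ (ℤ/h)^T | ∀ v ∈ Λ, ∑ a_t v_t = 0}`,
a finite additive group on which the tree's `CoprimePairing` and subgroup counting apply.

* `annih h Λ` (an `AddSubgroup (Fin T → ZMod h)`), `dotHom`; `annih_eq_range_charCoordHom` — the annihilator is the image of
  the (injective) coordinate map `AddChar (ℤ^T/Λ) ℂ → (ℤ/h)^T` of `HallgrenClassGroupCharacterCoordinates` at the generators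
  `e_t + Λ`; hence **`card_annih : Nat.card (annih h Λ) = h`** (`AddChar.card_eq`: `|Â| = |A|`);
* `repQ h a = (a_t.val / h)_t ∈ [0,1)^T`, `resZ h ξ = (⌊ξ_t h⌋ mod h)_t` and the dictionary with the rational representatives
  (the vectors of `[0,1)^T ∩ ℚ^T` pairing integrally with `Λ`, `CubicClassSampling.dualReps`, whose two defining clauses are
  taken here as explicit hypotheses): `resZ_mem_annih`, `repQ_resZ`, `repQ_pairs_int`, `resZ_repQ`, `den_repQ_dvd`,
  `exists_repQ_comb_eq` (representatives of integer combinations), `exists_sep_of_ne` (distinct representatives are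
  `1/h`-separated modulo `1` in some coordinate).

Theorem file with real definitions; no named facts. [Kitaev 1995, §4; Hallgren 2005, §4]

## References

* A. Yu. Kitaev, arXiv:quant-ph/9511026 (1995), §4 (the stabiliser from the measured characters). [Kitaev1995]
* S. Hallgren, STOC 2005, §4. [Hallgren2005]
-/

noncomputable section

namespace Literature.Computability.Cryptography

namespace CubicClassPost

open Finset

variable {T : ℕ}

/-! ### The annihilator subgroup -/

/-- **The annihilator of `Λ` in `(ℤ/h)^T`** under the dot product: `{a | ∀ v ∈ Λ, ∑_t a_t v_t = 0 (mod h)}`; for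
`h = [ℤ^T : Λ]` this is (a copy of) the dual group `Λ^*/ℤ^T = Hom(ℤ^T/Λ, ℚ/ℤ)`. [cite: Kitaev1995, §4] -/
def annih (h : ℕ) (Λ : AddSubgroup (Fin T → ℤ)) : AddSubgroup (Fin T → ZMod h) where
  carrier := {a | ∀ v ∈ Λ, ∑ t, a t * ((v t : ℤ) : ZMod h) = 0}
  zero_mem' := by
    intro v _
    simp
  add_mem' := by
    intro a b ha hb v hv
    have ha' := ha v hv
    have hb' := hb v hv
    simp only [Pi.add_apply, add_mul, sum_add_distrib] at ha' hb' ⊢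
    rw [ha', hb', add_zero]
  neg_mem' := by
    intro a ha v hv
    have ha' := ha v hv
    simp only [Pi.neg_apply, neg_mul, sum_neg_distrib, neg_eq_zero] at ha' ⊢
    exact ha'

/-- Membership in the annihilator. [folklore] -/
theorem mem_annih {h : ℕ} {Λ : AddSubgroup (Fin T → ℤ)} {a : Fin T → ZMod h} :
    a ∈ annih h Λ ↔ ∀ v ∈ Λ, ∑ t, a t * ((v t : ℤ) : ZMod h) = 0 := Iff.rfl

/-- The dot product with `a ∈ (ℤ/h)^T`, as a homomorphism `ℤ^T → ℤ/h`. [folklore] -/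
def dotHom (h : ℕ) (a : Fin T → ZMod h) : (Fin T → ℤ) →+ ZMod h :=
  AddMonoidHom.mk' (fun v => ∑ t, a t * ((v t : ℤ) : ZMod h)) (by
    intro v w
    simp only [Pi.add_apply, Int.cast_add, mul_add, sum_add_distrib])

/-- `dotHom` evaluates the dot product. [folklore] -/
@[simp] theorem dotHom_apply (h : ℕ) (a : Fin T → ZMod h) (v : Fin T → ℤ) :
    dotHom h a v = ∑ t, a t * ((v t : ℤ) : ZMod h) := rfl

/-- The dot product with a basis vector is the coordinate. [folklore] -/
theorem dotHom_single (h : ℕ) (a : Fin T → ZMod h) (t : Fin T) : dotHom h a (Pi.single t 1) = a t := by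
  rw [dotHom_apply, Finset.sum_eq_single t]
  · simp
  · intro s _ hs
    simp [hs]
  · intro ht; exact absurd (mem_univ t) ht

/-- Every integer vector is the combination of the basis vectors with its coordinates. [folklore] -/
theorem eq_sum_zsmul_single (v : Fin T → ℤ) : v = ∑ t, v t • (Pi.single t (1 : ℤ) : Fin T → ℤ) := by
  conv_lhs => rw [← Finset.univ_sum_single v]
  refine Finset.sum_congr rfl fun t _ => ?_
  ext s
  simp [Pi.single_apply]

/-! ### The annihilator is the character group of `ℤ^T/Λ` -/

section Characters

variable (Λ : AddSubgroup (Fin T → ℤ)) (h : ℕ) [NeZero h]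

/-- The generators `e_t + Λ` of `ℤ^T/Λ`. [folklore] -/
def gens (t : Fin T) : (Fin T → ℤ) ⧸ Λ := ((Pi.single t (1 : ℤ) : Fin T → ℤ) : (Fin T → ℤ) ⧸ Λ)

/-- The `e_t + Λ` generate `ℤ^T/Λ`. [folklore] -/
theorem closure_range_gens : AddSubgroup.closure (Set.range (gens Λ)) = ⊤ := by
  rw [eq_top_iff]
  intro x _
  induction x using QuotientAddGroup.induction_on with
  | H v =>
    rw [eq_sum_zsmul_single v, QuotientAddGroup.mk_sum]
    refine AddSubgroup.sum_mem _ fun t _ => ?_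
    rw [QuotientAddGroup.mk_zsmul]
    exact AddSubgroup.zsmul_mem _ (AddSubgroup.subset_closure (Set.mem_range_self t)) _

variable {Λ h}

omit [NeZero h] in
/-- `h = [ℤ^T : Λ]` kills `ℤ^T/Λ`. [folklore] -/
theorem index_kills (hh : Λ.index = h) (x : (Fin T → ℤ) ⧸ Λ) : h • x = 0 := by
  induction x using QuotientAddGroup.induction_on with
  | H v =>
    rw [← QuotientAddGroup.mk_nsmul, QuotientAddGroup.eq_zero_iff, ← hh]
    exact AddSubgroup.nsmul_index_mem Λ v

/-- The exponent of a value of the standard character of `ℤ/h` is the argument: `rootLog (e(x/h)) = x`. [folklore] -/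
theorem rootLog_stdAddChar (x : ZMod h) : Hallgren2005.rootLog h (ZMod.stdAddChar x) = x := by
  have key : ∀ j : ℕ, Hallgren2005.rootLog h (ZMod.stdAddChar (j : ZMod h)) = (j : ZMod h) := by
    intro j
    symm
    apply Hallgren2005.natCast_eq_rootLog_of_pow_eq
    rw [Hallgren2005.zeta_pow_eq_exp, ZMod.stdAddChar_apply, ZMod.toCircle_natCast]
    congr 1
    ring
  have := key x.val
  rwa [ZMod.natCast_zmod_val] at this

/-- **The coordinates of a character annihilate `Λ`**: for `χ ∈ (ℤ^T/Λ)^∧`, the vector `(rootLog χ(e_t + Λ))_t` lies in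
`annih h Λ` (the map `v ↦ rootLog χ(v + Λ)` is additive and vanishes on `Λ`). [cite: Kitaev1995, §4] -/
theorem charCoord_mem_annih (hh : Λ.index = h) (χ : AddChar ((Fin T → ℤ) ⧸ Λ) ℂ) :
    Hallgren2005.charCoord (gens Λ) h χ ∈ annih h Λ := by
  have hkill := index_kills hh
  have hpow : ∀ x : (Fin T → ℤ) ⧸ Λ, χ x ^ h = 1 := Hallgren2005.addChar_apply_pow_eq_one h hkill χ
  -- `v ↦ rootLog χ(v + Λ)` as a homomorphism
  let ρ : (Fin T → ℤ) →+ ZMod h := AddMonoidHom.mk'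
    (fun v => Hallgren2005.rootLog h (χ ((v : (Fin T → ℤ) ⧸ Λ)))) (by
      intro v w
      simp only [QuotientAddGroup.mk_add, AddChar.map_add_eq_mul]
      exact Hallgren2005.rootLog_mul h (hpow _) (hpow _))
  have hρ : ∀ v : Fin T → ℤ, ρ v = Hallgren2005.rootLog h (χ ((v : (Fin T → ℤ) ⧸ Λ))) := fun v => rfl
  intro v hv
  have hcoord : ∀ t : Fin T, Hallgren2005.charCoord (gens Λ) h χ t = ρ (Pi.single t 1) := fun t => rfl
  calc ∑ t, Hallgren2005.charCoord (gens Λ) h χ t * ((v t : ℤ) : ZMod h)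
      = ∑ t, ρ (v t • (Pi.single t (1 : ℤ) : Fin T → ℤ)) := by
        refine sum_congr rfl fun t _ => ?_
        rw [hcoord, map_zsmul, zsmul_eq_mul, mul_comm]
    _ = ρ v := by rw [← map_sum, ← eq_sum_zsmul_single v]
    _ = 0 := by
        rw [hρ, (QuotientAddGroup.eq_zero_iff v).2 hv, AddChar.map_zero_eq_one, Hallgren2005.rootLog_one]

/-- **Every annihilating vector is the coordinate vector of a character**: `a ∈ annih h Λ` defines the character
`v + Λ ↦ e((∑ a_t v_t)/h)`, whose coordinates are `a`. [cite: Kitaev1995, §4] -/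
theorem exists_charCoord_eq {a : Fin T → ZMod h} (ha : a ∈ annih h Λ) :
    ∃ χ : AddChar ((Fin T → ℤ) ⧸ Λ) ℂ, Hallgren2005.charCoord (gens Λ) h χ = a := by
  have hker : Λ ≤ (dotHom h a).ker := fun v hv => (AddMonoidHom.mem_ker).2 (ha v hv)
  refine ⟨(ZMod.stdAddChar : AddChar (ZMod h) ℂ).compAddMonoidHom (QuotientAddGroup.lift Λ (dotHom h a) hker), ?_⟩
  funext t
  simp only [Hallgren2005.charCoord, gens, AddChar.compAddMonoidHom_apply, QuotientAddGroup.lift_mk, dotHom_single,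
    rootLog_stdAddChar]

/-- **The annihilator is the image of the character group** under the coordinate map at the generators `e_t + Λ`.
[cite: Kitaev1995, §4] -/
theorem annih_eq_range_charCoordHom (hh : Λ.index = h) :
    annih h Λ = (Hallgren2005.charCoordHom (gens Λ) h (index_kills hh)).range := by
  ext a
  rw [AddMonoidHom.mem_range]
  constructor
  · intro ha
    obtain ⟨χ, hχ⟩ := exists_charCoord_eq ha
    exact ⟨χ, hχ⟩
  · rintro ⟨χ, rfl⟩
    exact charCoord_mem_annih hh χ

/-- **The annihilator has `[ℤ^T : Λ]` elements** (`|Hom(ℤ^T/Λ, ℚ/ℤ)| = |ℤ^T/Λ|`, through `AddChar.card_eq`).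
[cite: Kitaev1995, §4] -/
theorem card_annih [Λ.FiniteIndex] (hh : Λ.index = h) : Nat.card (annih h Λ) = h := by
  haveI : Fintype ((Fin T → ℤ) ⧸ Λ) := Fintype.ofFinite _
  have hinj := Hallgren2005.charCoordHom_injective (gens Λ) h (index_kills hh) (closure_range_gens Λ)
  rw [annih_eq_range_charCoordHom hh, ← Nat.card_congr (AddMonoidHom.ofInjective hinj).toEquiv,
    Nat.card_eq_fintype_card, AddChar.card_eq, ← Nat.card_eq_fintype_card]
  exact hh

end Characters

/-! ### Rational representatives in `[0,1)^T` -/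

/-- The representative of `a ∈ (ℤ/h)^T` in `[0,1)^T ∩ ℚ^T`: `(a_t.val / h)_t`. [cite: Kitaev1995, §4] -/
def repQ (h : ℕ) (a : Fin T → ZMod h) : Fin T → ℚ := fun t => ((a t).val : ℚ) / h

/-- The residue vector `(⌊ξ_t h⌋ mod h)_t` of a rational vector (inverse of `repQ` on `((1/h)ℤ ∩ [0,1))^T`). [folklore] -/
def resZ (h : ℕ) (ξ : Fin T → ℚ) : Fin T → ZMod h := fun t => ((⌊ξ t * h⌋ : ℤ) : ZMod h)

variable {h : ℕ} [NeZero h] {Λ : AddSubgroup (Fin T → ℤ)}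

/-- `repQ` takes values in `[0,1)`. [folklore] -/
theorem repQ_nonneg_lt (a : Fin T → ZMod h) (t : Fin T) : 0 ≤ repQ h a t ∧ repQ h a t < 1 := by
  have hh : (0 : ℚ) < h := by exact_mod_cast Nat.pos_of_ne_zero (NeZero.ne h)
  refine ⟨div_nonneg (by positivity) hh.le, ?_⟩
  rw [repQ, div_lt_one hh]
  exact_mod_cast ZMod.val_lt (a t)

/-- `repQ a · h` is the integer `a_t.val`. [folklore] -/
theorem repQ_mul (a : Fin T → ZMod h) (t : Fin T) : repQ h a t * h = (a t).val := by
  have hh : (h : ℚ) ≠ 0 := by exact_mod_cast NeZero.ne h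
  rw [repQ, div_mul_cancel₀ _ hh]

/-- `resZ ∘ repQ = id`. [folklore] -/
theorem resZ_repQ (a : Fin T → ZMod h) : resZ h (repQ h a) = a := by
  funext t
  rw [resZ, repQ_mul, show ((a t).val : ℚ) = (((a t).val : ℤ) : ℚ) by push_cast; rfl, Int.floor_intCast,
    Int.cast_natCast, ZMod.natCast_zmod_val]

omit [NeZero h] in
/-- The coordinates of a vector pairing integrally with `Λ` are `h`-th fractions: `ξ_t h ∈ ℤ` (pair with `h e_t ∈ Λ`).
[folklore] -/
theorem exists_mul_index_eq [Λ.FiniteIndex] (hh : Λ.index = h) {ξ : Fin T → ℚ}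
    (hξ : ∀ v ∈ Λ, ∃ z : ℤ, ∑ t, ξ t * (v t : ℚ) = z) (t : Fin T) : ∃ z : ℤ, ξ t * h = z := by
  obtain ⟨z, hz⟩ := hξ _ (hh ▸ AddSubgroup.nsmul_index_mem Λ (Pi.single t (1 : ℤ)))
  refine ⟨z, ?_⟩
  rw [← hz, Finset.sum_eq_single t]
  · simp
  · intro s _ hs; simp [hs]
  · intro ht; exact absurd (mem_univ t) ht

/-- `repQ ∘ resZ = id` on the representatives in `[0,1)^T` of the dual group (`CubicClassSampling.dualReps`). [folklore] -/
theorem repQ_resZ [Λ.FiniteIndex] (hh : Λ.index = h) {ξ : Fin T → ℚ} (hξ₀ : ∀ t, 0 ≤ ξ t ∧ ξ t < 1)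
    (hξ : ∀ v ∈ Λ, ∃ z : ℤ, ∑ t, ξ t * (v t : ℚ) = z) : repQ h (resZ h ξ) = ξ := by
  have hh0 : (0 : ℚ) < h := by exact_mod_cast Nat.pos_of_ne_zero (NeZero.ne h)
  funext t
  obtain ⟨z, hz⟩ := exists_mul_index_eq hh hξ t
  have hz0 : 0 ≤ z := by
    have : (0 : ℚ) ≤ z := by rw [← hz]; exact mul_nonneg (hξ₀ t).1 hh0.le
    exact_mod_cast this
  have hzh : z < h := by
    have : (z : ℚ) < h := by rw [← hz]; exact mul_lt_of_lt_one_left hh0 (hξ₀ t).2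
    exact_mod_cast this
  rw [repQ, resZ, hz, Int.floor_intCast]
  lift z to ℕ using hz0
  push_cast at hz
  rw [Int.cast_natCast, ZMod.val_cast_of_lt (by exact_mod_cast hzh), div_eq_iff hh0.ne', hz]

omit [NeZero h] in
/-- **A vector pairing integrally with `Λ` gives an annihilating residue vector** (`resZ ξ ∈ annih h Λ`):
`∑ (ξ_t h) v_t = h (∑ ξ_t v_t) ≡ 0`. [cite: Kitaev1995, §4] -/
theorem resZ_mem_annih [Λ.FiniteIndex] (hh : Λ.index = h) {ξ : Fin T → ℚ}
    (hξ : ∀ v ∈ Λ, ∃ z : ℤ, ∑ t, ξ t * (v t : ℚ) = z) : resZ h ξ ∈ annih h Λ := by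
  intro v hv
  obtain ⟨z, hz⟩ := hξ v hv
  choose n hn using exists_mul_index_eq hh hξ
  have hsum : ∑ t, n t * v t = h * z := by
    have : ((∑ t, n t * v t : ℤ) : ℚ) = ((h * z : ℤ) : ℚ) := by
      push_cast
      rw [← hz, Finset.mul_sum]
      refine sum_congr rfl fun t _ => ?_
      rw [← hn t]; ring
    exact_mod_cast this
  have : ∀ t, resZ h ξ t = ((n t : ℤ) : ZMod h) := fun t => by rw [resZ, hn t, Int.floor_intCast]
  simp_rw [this]
  rw [show (∑ t, ((n t : ℤ) : ZMod h) * ((v t : ℤ) : ZMod h)) = ((∑ t, n t * v t : ℤ) : ZMod h) by push_cast; rfl,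
    hsum]
  push_cast
  rw [ZMod.natCast_self, zero_mul]

/-- **`repQ a` pairs integrally with `Λ`** for `a ∈ annih h Λ` (with `repQ_nonneg_lt`: it is the representative of a
character in `[0,1)^T`, `CubicClassSampling.dualReps`). [cite: Kitaev1995, §4] -/
theorem repQ_pairs_int {a : Fin T → ZMod h} (ha : a ∈ annih h Λ) (v : Fin T → ℤ) (hv : v ∈ Λ) :
    ∃ z : ℤ, ∑ t, repQ h a t * (v t : ℚ) = z := by
  have hh0 : (h : ℚ) ≠ 0 := by exact_mod_cast NeZero.ne h
  -- `∑ a_t.val v_t ≡ 0 (mod h)`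
  have hdvd : (h : ℤ) ∣ ∑ t, ((a t).val : ℤ) * v t := by
    rw [← ZMod.intCast_zmod_eq_zero_iff_dvd]
    push_cast
    simp only [ZMod.natCast_val, ZMod.cast_id', id_eq]
    exact ha v hv
  obtain ⟨z, hz⟩ := hdvd
  refine ⟨z, ?_⟩
  have : (∑ t, repQ h a t * (v t : ℚ)) * h = z * h := by
    rw [Finset.sum_mul]
    calc ∑ t, repQ h a t * (v t : ℚ) * h = ∑ t, (((a t).val : ℤ) : ℚ) * (v t : ℚ) := by
          refine sum_congr rfl fun t _ => ?_
          rw [mul_right_comm, repQ_mul]; push_cast; ring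
      _ = ((∑ t, ((a t).val : ℤ) * v t : ℤ) : ℚ) := by push_cast; rfl
      _ = z * h := by rw [hz]; push_cast; ring
  exact mul_right_cancel₀ hh0 this

omit [NeZero h] in
/-- The denominators of `repQ a` divide `h`. [folklore] -/
theorem den_repQ_dvd (a : Fin T → ZMod h) (t : Fin T) : (repQ h a t).den ∣ h := by
  have := Rat.den_dvd ((a t).val : ℤ) (h : ℤ)
  rw [Rat.divInt_eq_div] at this
  push_cast at this
  exact_mod_cast this

/-- **Representatives of integer lifts**: if `z ≡ x (mod h)` then `x.val / h = z / h + m` for an integer `m`. [folklore] -/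
theorem exists_val_div_eq_add_int (x : ZMod h) {z : ℤ} (hz : (z : ZMod h) = x) :
    ∃ m : ℤ, ((x.val : ℚ) / h) = (z : ℚ) / h + m := by
  have hh0 : (h : ℚ) ≠ 0 := by exact_mod_cast NeZero.ne h
  have hdvd : (h : ℤ) ∣ (x.val : ℤ) - z := by
    rw [← ZMod.intCast_zmod_eq_zero_iff_dvd]
    push_cast
    rw [ZMod.natCast_zmod_val, hz, sub_self]
  obtain ⟨m, hm⟩ := hdvd
  refine ⟨m, ?_⟩
  rw [div_add' _ _ _ hh0, div_eq_div_iff hh0 hh0]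
  have : ((x.val : ℤ) : ℚ) = z + h * m := by rw [← sub_eq_iff_eq_add', ← Int.cast_sub, hm]; push_cast; ring
  push_cast at this
  rw [this]; ring

/-- **Representatives of combinations**: `repQ (c₁ • a + c₂ • b) ≡ c₁ repQ a + c₂ repQ b (mod ℤ^T)`. [folklore] -/
theorem exists_repQ_comb_eq (c₁ c₂ : ℤ) (a b : Fin T → ZMod h) (t : Fin T) :
    ∃ m : ℤ, repQ h (c₁ • a + c₂ • b) t = c₁ * repQ h a t + c₂ * repQ h b t + m := by
  obtain ⟨m, hm⟩ := exists_val_div_eq_add_int ((c₁ • a + c₂ • b) t)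
    (z := c₁ * (a t).val + c₂ * (b t).val) (by
      push_cast
      rw [ZMod.natCast_zmod_val, ZMod.natCast_zmod_val, Pi.add_apply, Pi.smul_apply, Pi.smul_apply, zsmul_eq_mul,
        zsmul_eq_mul])
  refine ⟨m, ?_⟩
  rw [repQ, hm, repQ, repQ]
  push_cast
  ring

/-- **Distinct representatives are `1/h`-separated modulo `1`** in some coordinate. [folklore] -/
theorem exists_sep_of_ne {a b : Fin T → ZMod h} (hab : a ≠ b) :
    ∃ t : Fin T, ∀ m : ℤ, (1 : ℝ) / h ≤ |((repQ h a t : ℚ) : ℝ) - ((repQ h b t : ℚ) : ℝ) - m| := by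
  obtain ⟨t, ht⟩ : ∃ t, a t ≠ b t := by
    by_contra hcon
    push Not at hcon
    exact hab (funext hcon)
  refine ⟨t, fun m => ?_⟩
  have hh0 : (0 : ℝ) < h := by exact_mod_cast Nat.pos_of_ne_zero (NeZero.ne h)
  have hval : (a t).val ≠ (b t).val := fun e => ht (ZMod.val_injective h e)
  -- the difference is `(a.val - b.val - m h)/h` with a numerator that is a non-zero integer
  set d : ℤ := ((a t).val : ℤ) - (b t).val - m * h with hd
  have hd0 : d ≠ 0 := by
    intro h0
    have hmod : (((a t).val : ℤ) : ZMod h) = (((b t).val : ℤ) : ZMod h) := by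
      have : ((a t).val : ℤ) = (b t).val + m * h := by omega
      rw [this]; push_cast; rw [ZMod.natCast_self, mul_zero, add_zero]
    push_cast at hmod
    rw [ZMod.natCast_zmod_val, ZMod.natCast_zmod_val] at hmod
    exact ht hmod
  have hexpr : ((repQ h a t : ℚ) : ℝ) - ((repQ h b t : ℚ) : ℝ) - m = (d : ℝ) / h := by
    simp only [repQ, hd, Rat.cast_div, Rat.cast_natCast]
    field_simp
    push_cast
    ring
  rw [hexpr, abs_div, abs_of_pos hh0]
  have : (1 : ℝ) ≤ |(d : ℝ)| := by
    rw [← Int.cast_abs]; exact_mod_cast Int.one_le_abs hd0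
  exact div_le_div_of_nonneg_right this hh0.le

/-- **Summary (uncurried form)**: the annihilator in `(ℤ/h)^T` of a lattice `Λ ≤ ℤ^T` of index `h` — the dual group
`Λ^*/ℤ^T` — has exactly `h` elements. [cite: Kitaev1995, §4] -/
theorem card_annih_of_index_eq : ∀ (T h : ℕ) (Λ : AddSubgroup (Fin T → ℤ)) [Λ.FiniteIndex] [NeZero h],
    Λ.index = h → Nat.card (annih h Λ) = h :=
  fun _ _ _ _ _ hh => card_annih hh

end CubicClassPost

end Literature.Computability.Cryptography

end
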